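import Summits.BirchSwinnertonDyer.BirchSwinnertonDyer.Theorems.GenusKolyvaginAtTwoGenusPrimitiveSupplyAtTwoArchimedeanUnramifiedRowsHold
import Summits.BirchSwinnertonDyer.BirchSwinnertonDyer.Theorems.GenusKolyvaginAtTwoMazurRubinLemma210Rat
import HarnessLib

/-!
# Route `GenusKolyvaginAtTwo`, crux #2 `GenusPrimitiveSupplyAtTwo` (stmt-BirchSwinnertonDyer-22136):
# THE NORM-CLEAN TWIST LAW over `ℚ` — Kramer's Theorem 1 when every finite local norm index vanishes
# (`F1Sign2.KramerNormCleanSuff W d`): `#Sel₂(W^{(d)}) = #Sel₂(W)` unless `d < 0 < Δ_W`, and then a shift by exactly one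

Width seat `bsd-line-gk2-p5` g12 (cell `bsd-f1-sign2`, SUPPLY lineage), file 47 of the series: sequel of `…ArchimedeanUnramifiedRowsHold`
(§100–§101: T-A⁵ / T-A⁵′ by name) and of g11's `…MazurRubinLemma210Rat` (the `T = ∅` discharge over `ℚ`). THEOREMS ONLY (no definition,
no named fact, no `sorry`, no local instance); helper `--supports stmt-BirchSwinnertonDyer-22136`; no item is closed; BSD is not proved by
any of this.

WHAT. The `-desc` cell definition `F1Sign2.KramerNormCleanSuff W d` (for `-an`, D-desc-an-2 / AN-10H♯; MEMO-desc §13.3 row NC) is an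
elementary SUFFICIENT condition for the vanishing of EVERY finite local norm index `i_v` of Kramer 1981 for `ℚ(√d)/ℚ`: `d` squarefree with
`d ≡ 1 (mod 8)`, or `d ≡ 5 (mod 8)` and `W` good at `2`; primes of `d` good with `a_q` odd; odd bad primes `∤ d` split, or multiplicative
with `v_ℓ(Δ)` odd and inert. It contains both admissibility notions (`descAdmissible_normClean`, `descAdmissibleUnram_normClean`). Here the
corresponding SELMER LAW is proved by name, for every globally minimal elliptic `W/ℚ` (no image hypothesis, no sign condition on `d`):

* §105 `normClean_place_menu₅` — `KramerNormCleanSuff W d` puts EVERY finite place of `ℚ` on the five-row menu for the pair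
  `(W, W^{(d)})` (split | Tamagawa-odd both | good both | silent both | unramified-good at `2`);
* §106 **`twistSelmerTwoCard_eq_of_normClean_of_pos`** (`d > 0`: `#Sel₂(W^{(d)}) = #Sel₂(W)`), **`twistSelmerTwoCard_eq_of_normClean_of_Δ_neg`**
  (`Δ_W < 0`: `#Sel₂(W^{(d)}) = #Sel₂(W)`), **`twistSelmerTwoCard_shift_of_normClean`** (`d < 0 < Δ_W`: `2·#Sel₂(W^{(d)}) = #Sel₂(W)` or
  `#Sel₂(W^{(d)}) = 2·#Sel₂(W)`, DOWN iff some Selmer class is non-trivial at `∞` — `twistSelmerTwoCard_eq_two_mul_of_strict_of_normClean`,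
  `two_mul_twistSelmerTwoCard_eq_of_exists_of_normClean`), `twistSelmerTwoCard_eq_of_normClean_neg` (level law: all norm-clean `d < 0` give the
  same `#Sel₂(W^{(d)})` when `Δ_W > 0`) — Kramer's Thm. 1 / Mazur–Rubin Cor. 3.4 with `T ⊆ {∞}`, unconditional (PT, Tate χ, Kramer's
  congruence for the framed identification, Mazur's norm theorem, Kramer Props. 1, 2 (a), 3 are tree theorems).

Honest framing: Kramer 1981 bookkeeping (KNOWN); beyond-print theorem: no; no item closed; crux 22136 stays OPEN at (U) ∧ (CONV₂).

References: [Kramer1981] Thm. 1, §2 Props. 1, 2 (a), 3, 6; [Mazur1972] Cor. 4.4; [MazurRubin2010] Thm. 2.7, Lemmas 2.9–2.10, Prop. 3.3,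
Cor. 3.4; [Serre1973] II.3.3; [MilneADT2006] I Thm. 2.8, 2.13, 4.10.
-/

set_option linter.dupNamespace false -- tree convention: `Summit.BirchSwinnertonDyer.BirchSwinnertonDyer.Theorems` (summit = sub-problem)
set_option autoImplicit false

noncomputable section

open scoped Classical ContRepresentation

namespace Summit.BirchSwinnertonDyer.BirchSwinnertonDyer.Theorems.GenusKolyArch

open WeierstrassCurve Field NumberField IsDedekindDomain Function
open Literature.NumberTheory.EllipticCurves Literature.NumberTheory.GaloisRepresentations
open Literature.NumberTheory.GaloisRepresentations.IsNonarchimedeanLocalField (maxUnramified)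
open Literature.NumberTheory.GaloisCohomology
open Summit.BirchSwinnertonDyer.BirchSwinnertonDyer.Theorems.GenusKolyTwistTamagawa
open Summit.BirchSwinnertonDyer.BirchSwinnertonDyer.Theorems.GenusKolyTwistingPrime (natCast_not_mem_of_not_dvd)
open Summit.BirchSwinnertonDyer.Rank1Residual.F1Sign2
open Rat.HeightOneSpectrum (primesEquiv natGenerator)

/-! ## §105 A norm-clean `d` puts every finite place of `ℚ` on the five-row menu -/

section Menu

variable (W : WeierstrassCurve ℚ) [W.IsElliptic] [W.IsGloballyMinimal]

/-- **The five-row finite place menu for a NORM-CLEAN twist parameter.** `W/ℚ` globally minimal elliptic, `d` with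
`F1Sign2.KramerNormCleanSuff W d`: every finite place `v` of `ℚ` is on the five-row menu for the pair `(W, W^{(d)})` — over `2`: split
(`d ≡ 1 (mod 8)`) or the unramified-good row (`d ≡ 5 (mod 8)`, `W` good at `2`, `ι√d ∈ ℚ₂^{nr}`); over a prime of `d`: odd, good, `a_q`
odd ⟹ silent for both; over an odd bad prime `∤ d`: split (`(d/ℓ) = 1`) or multiplicative with `v_ℓ(Δ)` odd for both (the Tamagawa-odd
row; `(d/ℓ) = −1` is not even needed); elsewhere odd and good for both.
[cite: Kramer1981, §2 Props. 1, 2 (a), 3] [cite: Mazur1972, Cor. 4.4] [cite: Serre1973, Ch. II §3.3 Thm 3–4] [cite: MazurRubin2010, Lemma 2.10] -/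
theorem normClean_place_menu₅ {d : ℤ} [(W.quadraticTwist (d : ℚ)).IsElliptic] (hNC : KramerNormCleanSuff W d) :
    ∀ v : HeightOneSpectrum (𝓞 ℚ),
      (∃ s : v.adicCompletion ℚ, s ^ 2 = algebraMap ℚ (v.adicCompletion ℚ) (d : ℚ)) ∨
      (((2 : ℕ) : 𝓞 ℚ) ∉ v.asIdeal ∧
        ¬ 2 ∣ (W.baseChange (v.adicCompletion ℚ)).localTamagawaNumber (v.adicCompletionIntegers ℚ) ∧
        ¬ 2 ∣ ((W.quadraticTwist (d : ℚ)).baseChange (v.adicCompletion ℚ)).localTamagawaNumber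
          (v.adicCompletionIntegers ℚ)) ∨
      (((2 : ℕ) : 𝓞 ℚ) ∉ v.asIdeal ∧ W.HasGoodReductionAt v ∧ (W.quadraticTwist (d : ℚ)).HasGoodReductionAt v) ∨
      (((2 : ℕ) : 𝓞 ℚ) ∉ v.asIdeal ∧
        Nat.card (nsmulAddMonoidHom 2 : (W.baseChange (v.adicCompletion ℚ)).toAffine.Point →+ _).ker = 1 ∧
        Nat.card (nsmulAddMonoidHom 2 :
          ((W.quadraticTwist (d : ℚ)).baseChange (v.adicCompletion ℚ)).toAffine.Point →+ _).ker = 1) ∨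
      ((W.HasGoodReductionAt v ∨ (W.HasMultiplicativeReductionAt v ∧ Odd (W.ordMinimalDiscriminant v))) ∧
        closureEmb (K := ℚ) (v.adicCompletion ℚ) (geomSqrt (d : ℚ)) ∈ maxUnramified (v.adicCompletion ℚ)) := by
  obtain ⟨hsf, h2, hprimes, hbad⟩ := hNC
  have hd0 : d ≠ 0 := fun h ↦ by subst h; exact not_squarefree_zero hsf
  have hdQ : (d : ℚ) ≠ 0 := by exact_mod_cast hd0
  intro v
  haveI := Fact.mk (primesEquiv v).2
  have hpP : (primesEquiv v : ℕ).Prime := (primesEquiv v).2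
  have hpv : ((primesEquiv v : ℕ) : 𝓞 ℚ) ∈ v.asIdeal := Rat.HeightOneSpectrum.natCast_natGenerator_mem v
  -- a `p`-adic square gives the split option
  have hsplit : IsSquare ((d : ℤ) : ℚ_[(primesEquiv v : ℕ)]) →
      ∃ s : v.adicCompletion ℚ, s ^ 2 = algebraMap ℚ (v.adicCompletion ℚ) (d : ℚ) := fun hsq ↦ by
    have hsq' : IsSquare (((d : ℚ) : ℚ) : ℚ_[(primesEquiv v : ℕ)]) := by
      simpa only [Rat.cast_intCast] using hsq
    obtain ⟨s, hs⟩ := TwoDescentLocal.isSquare_algebraMap_adicCompletion_of_padic v hsq'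
    exact ⟨s, by rw [sq]; exact hs.symm⟩
  by_cases hp2 : (primesEquiv v : ℕ) = 2
  · -- over `2`: `d ≡ 1 (mod 8)` is a `2`-adic square; `d ≡ 5 (mod 8)` with `W` good at `2` is the unramified-good row
    rcases h2 with hd8 | ⟨hd8, hgood2⟩
    · exact Or.inl (hsplit (Literature.NumberTheory.QuadraticForms.padic_isSquare_intCast_of_mod_eight hp2 hd8))
    · have h2v : ((2 : ℕ) : 𝓞 ℚ) ∈ v.asIdeal := by rw [← hp2]; exact hpv
      have hW : W.HasGoodReductionAt v := by
        by_contra h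
        have hdvd : (primesEquiv v : ℕ) ∣ W.conductorNorm ℤ := (W.dvd_conductorNorm_iff v).mpr h
        rw [hp2] at hdvd
        haveI : Fact (Nat.Prime 2) := ⟨Nat.prime_two⟩
        exact not_dvd_conductorNorm_of_hasGoodReductionAtPrime W (hgood2 inferInstance) hdvd
      exact Or.inr (Or.inr (Or.inr (Or.inr
        ⟨Or.inl hW, closureEmb_geomSqrt_mem_maxUnramified_of_emod_eight_eq_five v hp2 h2v hd8⟩)))
  have h2v : ((2 : ℕ) : 𝓞 ℚ) ∉ v.asIdeal :=
    natCast_not_mem_of_not_dvd hpP hpv fun h ↦ hp2 ((Nat.prime_dvd_prime_iff_eq hpP Nat.prime_two).mp h)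
  by_cases hpd : ((primesEquiv v : ℕ) : ℤ) ∣ d
  · -- over a prime of `d`: odd, good, `a_p` odd ⟹ silent for `W`, hence for `W^{(d)}`
    obtain ⟨hgood, hodd⟩ := hprimes _ hpP hpd
    have hgood' : W.HasGoodReductionAtPrime (primesEquiv v : ℕ) := hgood inferInstance
    have hpΔ : ¬ ((primesEquiv v : ℕ) : ℤ) ∣ minimalDiscriminantInt W :=
      W.not_dvd_minimalDiscriminantInt_of_hasGoodReductionAtPrime' _ hgood'
    have hsil := (GenusKolyTwin.silent_iff_odd_frobeniusTrace W hp2 hpΔ).mpr hodd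
    have h0 := GenusKolyTwin.twoTorsion_padic_eq_zero_of_forall_ne W hp2 hpΔ hsil
    refine Or.inr (Or.inr (Or.inr (Or.inl ⟨h2v, natCard_ker_nsmul_two_adicCompletion_eq_one_of_forall W v h0, ?_⟩)))
    refine natCard_ker_nsmul_two_adicCompletion_eq_one_of_forall (W.quadraticTwist (d : ℚ)) v ?_
    have hc : Nat.card {Q : ((W.quadraticTwist (d : ℚ)).baseChange
        ℚ_[((primesEquiv v : Nat.Primes) : ℕ)]).toAffine.Point // 2 • Q = 0} = 1 := by
      rw [natCard_twoTorsion_padic_twist_eq W hdQ (Wd := W.quadraticTwist (d : ℚ)) (C := 1) (one_smul _ _)]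
      haveI : Unique {Q : (W.baseChange ℚ_[((primesEquiv v : Nat.Primes) : ℕ)]).toAffine.Point // 2 • Q = 0} :=
        { default := ⟨0, by simp⟩
          uniq := fun Q ↦ Subtype.ext (h0 Q.1 Q.2) }
      exact Nat.card_unique
    intro Q hQ
    haveI : Finite {Q : ((W.quadraticTwist (d : ℚ)).baseChange
        ℚ_[((primesEquiv v : Nat.Primes) : ℕ)]).toAffine.Point // 2 • Q = 0} :=
      Nat.finite_of_card_ne_zero (by rw [hc]; norm_num)
    exact congrArg Subtype.val ((Nat.card_eq_one_iff_unique.mp hc).1.elim ⟨Q, hQ⟩ ⟨0, by simp⟩)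
  by_cases hpN : (primesEquiv v : ℕ) ∣ W.conductorNorm ℤ
  · -- over an odd bad prime `∤ d`: split, or multiplicative with `v_p(Δ)` odd (Tamagawa-odd for both curves)
    have hnotgood : ∀ _h : Fact (primesEquiv v : ℕ).Prime, ¬ W.HasGoodReductionAtPrime (primesEquiv v : ℕ) := fun _ hg ↦
      not_dvd_conductorNorm_of_hasGoodReductionAtPrime W hg hpN
    rcases hbad _ hpP hp2 hnotgood with hJ | ⟨hmultp, hodd, -⟩
    · exact Or.inl (hsplit (padic_isSquare_of_jacobiSym_eq_one hp2 hJ))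
    · have hmult : W.HasMultiplicativeReductionAt v :=
        (hasMultiplicativeReductionAtPrime_iff_hasMultiplicativeReductionAt_ringOfIntegers W v).mp (hmultp inferInstance)
      refine Or.inr (Or.inl ⟨h2v, ?_, ?_⟩)
      · exact not_two_dvd_localTamagawaNumber_of_mult_of_odd W v hmult
          ((odd_ordMinimalDiscriminant_iff_odd_padicValRat W v).mpr hodd)
      · exact not_two_dvd_localTamagawaNumber_of_mult_of_odd (W.quadraticTwist (d : ℚ)) v
          (hasMultiplicativeReductionAt_quadraticTwist_of_not_dvd_any W v hp2 hpd hmult)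
          ((odd_ordMinimalDiscriminant_iff_odd_padicValRat _ v).mpr
            ((odd_padicValRat_Δ_quadraticTwist_iff W hpd).mpr hodd))
  · -- over an odd good prime not dividing `d`: good for both
    have hW : W.HasGoodReductionAt v := by
      by_contra h
      exact hpN ((W.dvd_conductorNorm_iff v).mpr h)
    exact Or.inr (Or.inr (Or.inl ⟨h2v, hW, hasGoodReductionAt_quadraticTwist_of_not_dvd_any W v hp2 hpd hW⟩))

end Menu

/-! ## §106 The norm-clean twist law -/

section Law

variable (W : WeierstrassCurve ℚ) [W.IsElliptic] [W.IsGloballyMinimal]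

omit [W.IsElliptic] in
/-- A norm-clean parameter is non-zero (`Squarefree 0` fails). [folklore] -/
theorem ne_zero_of_normClean {d : ℤ} (hNC : KramerNormCleanSuff W d) : d ≠ 0 :=
  fun h ↦ by obtain ⟨hsf, -⟩ := hNC; subst h; exact not_squarefree_zero hsf

/-- **THE NORM-CLEAN TWIST LAW, `d > 0`: `#Sel₂(W^{(d)}) = #Sel₂(W)`** for every globally minimal elliptic `W/ℚ` and every `d > 0` with
`KramerNormCleanSuff W d` — Kramer's Thm. 1 with every local norm index zero (the real place splits in `ℚ(√d)`); Mazur–Rubin Cor. 3.4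
(ii) / Lemma 2.10 at every place (`T = ∅`), the dyadic place by the split row or Mazur's norm theorem. Unconditional (no duality).
[cite: Kramer1981, Thm. 1, §2 Props. 1, 2 (a), 3] [cite: Mazur1972, Cor. 4.4] [cite: MazurRubin2010, Lemma 2.10, Cor. 3.4 (ii)] -/
theorem twistSelmerTwoCard_eq_of_normClean_of_pos {d : ℤ} (hNC : KramerNormCleanSuff W d) (hd : 0 < d) :
    twistSelmerTwoCard W d = selmerTwoCard W := by
  have hd0 : d ≠ 0 := ne_zero_of_normClean W hNC
  have hdQ : ((d : ℤ) : ℚ) ≠ 0 := by exact_mod_cast hd0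
  haveI := W.isElliptic_quadraticTwist hdQ
  have hinf : ∀ w : InfinitePlace ℚ,
      (∃ s : w.Completion, s ^ 2 = algebraMap ℚ w.Completion ((d : ℤ) : ℚ)) ∨
      ((∀ y : galoisCohomology (W.localGaloisModule w.Completion) 1, y = 0) ∧
        (∀ y : galoisCohomology ((W.quadraticTwist ((d : ℤ) : ℚ)).localGaloisModule w.Completion) 1, y = 0)) := by
    intro w
    left
    obtain ⟨m, hm⟩ : ∃ m : ℕ, (m : ℤ) = d := ⟨d.natAbs, Int.natAbs_of_nonneg hd.le⟩
    obtain ⟨s, hs⟩ := GenusKolyLowering.exists_sq_eq_infinitePlace_completion w m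
    exact ⟨s, by rw [hs, ← hm, Int.cast_natCast]⟩
  have key := natCard_selmerGroup_twist_eq_of_menu₅ W hdQ (Wd := W.quadraticTwist ((d : ℤ) : ℚ)) (C := 1) (one_smul _ _)
    (normClean_place_menu₅ W hNC) hinf
  rw [Nat.cast_ofNat, GenusKolyTwin.natCard_selmerGroup_model_eq_twistSelmerTwoCard W hd0 _ ⟨1, one_smul _ _⟩] at key
  rw [key, selmerTwoCard]

/-- **THE NORM-CLEAN TWIST LAW, `Δ_W < 0`: `#Sel₂(W^{(d)}) = #Sel₂(W)`** for every globally minimal elliptic `W/ℚ` with `Δ_W < 0` and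
every `d` with `KramerNormCleanSuff W d` (either sign) — at the real place `H¹(ℝ, W) = H¹(ℝ, W^{(d)}) = 0` (both discriminants negative),
so again `T = ∅`. Unconditional. [cite: Kramer1981, Thm. 1, §2 Props. 1, 2 (a), 3, 6] [cite: MazurRubin2010, Lemma 2.10 (iv), Cor. 3.4 (ii)] -/
theorem twistSelmerTwoCard_eq_of_normClean_of_Δ_neg {d : ℤ} (hNC : KramerNormCleanSuff W d) (hΔ : W.Δ < 0) :
    twistSelmerTwoCard W d = selmerTwoCard W := by
  have hd0 : d ≠ 0 := ne_zero_of_normClean W hNC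
  have hdQ : ((d : ℤ) : ℚ) ≠ 0 := by exact_mod_cast hd0
  haveI := W.isElliptic_quadraticTwist hdQ
  have hneg' : (W.quadraticTwist ((d : ℤ) : ℚ)).Δ < 0 := by
    rw [quadraticTwist_Δ]
    exact mul_neg_of_pos_of_neg (by positivity) hΔ
  have hinf : ∀ w : InfinitePlace ℚ,
      (∃ s : w.Completion, s ^ 2 = algebraMap ℚ w.Completion ((d : ℤ) : ℚ)) ∨
      ((∀ y : galoisCohomology (W.localGaloisModule w.Completion) 1, y = 0) ∧
        (∀ y : galoisCohomology ((W.quadraticTwist ((d : ℤ) : ℚ)).localGaloisModule w.Completion) 1, y = 0)) :=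
    fun w ↦ Or.inr ⟨fun y ↦ GenusExact.ArchVanishing.localH1_infinitePlace_eq_zero_of_Δ_neg W w hΔ y,
      fun y ↦ GenusExact.ArchVanishing.localH1_infinitePlace_eq_zero_of_Δ_neg _ w hneg' y⟩
  have key := natCard_selmerGroup_twist_eq_of_menu₅ W hdQ (Wd := W.quadraticTwist ((d : ℤ) : ℚ)) (C := 1) (one_smul _ _)
    (normClean_place_menu₅ W hNC) hinf
  rw [Nat.cast_ofNat, GenusKolyTwin.natCard_selmerGroup_model_eq_twistSelmerTwoCard W hd0 _ ⟨1, one_smul _ _⟩] at key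
  rw [key, selmerTwoCard]

/-- **THE NORM-CLEAN TWIST LAW, `d < 0 < Δ_W`, UP**: `Sel₂(W)` strict at `∞` ⟹ `#Sel₂(W^{(d)}) = 2·#Sel₂(W)`. The only `T`-place is the
real place (`#𝓛_∞ = 2` as `Δ_W > 0`; `d < 0` is not a real square). §99 with §105's menu.
[cite: Kramer1981, Thm. 1, §2 Prop. 6] [cite: MazurRubin2010, Thm. 2.7, Lemma 2.9, Cor. 3.4 (i)] -/
theorem twistSelmerTwoCard_eq_two_mul_of_strict_of_normClean (hΔ : 0 < W.Δ)
    (hstrict : ∀ c ∈ (W.kummerSelmerStructure ((2 : ℕ) : ℤ)).selmerGroup,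
      galoisCohomology.localization (W.torsionGaloisModule ((2 : ℕ) : ℤ)) (Sum.inl Rat.infinitePlace) 1 c = 0)
    {d : ℤ} (hNC : KramerNormCleanSuff W d) (hd : d < 0) :
    twistSelmerTwoCard W d = 2 * selmerTwoCard W := by
  have hd0 : d ≠ 0 := hd.ne
  have hdQ : ((d : ℤ) : ℚ) ≠ 0 := by exact_mod_cast hd0
  haveI := W.isElliptic_quadraticTwist hdQ
  have hw₀ : (Rat.infinitePlace).IsReal := Rat.isReal_infinitePlace
  have hΔ' : 0 < InfinitePlace.embedding_of_isReal hw₀ W.Δ := by rwa [embedding_of_isReal_rat_apply, Rat.cast_pos]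
  have hinf : ∀ w : InfinitePlace ℚ, w ≠ Rat.infinitePlace →
      (∃ s : w.Completion, s ^ 2 = algebraMap ℚ w.Completion ((d : ℤ) : ℚ)) ∨
      ((∀ x : galoisCohomology (W.localGaloisModule w.Completion) 1, x = 0) ∧
        (∀ x : galoisCohomology ((W.quadraticTwist ((d : ℤ) : ℚ)).localGaloisModule w.Completion) 1, x = 0)) :=
    fun w hw ↦ absurd (Subsingleton.elim w _) hw
  have h := natCard_selmerGroup_twist_eq_mul_two_of_menu₅_inl W hdQ (Wd := W.quadraticTwist ((d : ℤ) : ℚ)) (C := 1)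
    (one_smul _ _) hw₀ hΔ' (forall_sq_ne_completion_of_neg (by exact_mod_cast hd) _) (normClean_place_menu₅ W hNC) hinf hstrict
  rw [Nat.cast_ofNat, GenusKolyTwin.natCard_selmerGroup_model_eq_twistSelmerTwoCard W hd0 _ ⟨1, one_smul _ _⟩] at h
  rw [h, selmerTwoCard, mul_comm]

/-- **THE NORM-CLEAN TWIST LAW, `d < 0 < Δ_W`, DOWN**: some class of `Sel₂(W)` non-trivial at `∞` ⟹ `2·#Sel₂(W^{(d)}) = #Sel₂(W)`.
[cite: Kramer1981, Thm. 1, §2 Prop. 6] [cite: MazurRubin2010, Lemma 2.9, Prop. 3.3, Cor. 3.4 (i)] -/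
theorem two_mul_twistSelmerTwoCard_eq_of_exists_of_normClean (hΔ : 0 < W.Δ)
    (hns : ∃ c ∈ (W.kummerSelmerStructure ((2 : ℕ) : ℤ)).selmerGroup,
      galoisCohomology.localization (W.torsionGaloisModule ((2 : ℕ) : ℤ)) (Sum.inl Rat.infinitePlace) 1 c ≠ 0)
    {d : ℤ} (hNC : KramerNormCleanSuff W d) (hd : d < 0) :
    2 * twistSelmerTwoCard W d = selmerTwoCard W := by
  have hd0 : d ≠ 0 := hd.ne
  have hdQ : ((d : ℤ) : ℚ) ≠ 0 := by exact_mod_cast hd0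
  haveI := W.isElliptic_quadraticTwist hdQ
  have hw₀ : (Rat.infinitePlace).IsReal := Rat.isReal_infinitePlace
  have hΔ' : 0 < InfinitePlace.embedding_of_isReal hw₀ W.Δ := by rwa [embedding_of_isReal_rat_apply, Rat.cast_pos]
  have hinf : ∀ w : InfinitePlace ℚ, w ≠ Rat.infinitePlace →
      (∃ s : w.Completion, s ^ 2 = algebraMap ℚ w.Completion ((d : ℤ) : ℚ)) ∨
      ((∀ x : galoisCohomology (W.localGaloisModule w.Completion) 1, x = 0) ∧
        (∀ x : galoisCohomology ((W.quadraticTwist ((d : ℤ) : ℚ)).localGaloisModule w.Completion) 1, x = 0)) :=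
    fun w hw ↦ absurd (Subsingleton.elim w _) hw
  have h := natCard_selmerGroup_twist_mul_two_eq_of_menu₅_inl W hdQ (Wd := W.quadraticTwist ((d : ℤ) : ℚ)) (C := 1)
    (one_smul _ _) hw₀ hΔ' (forall_sq_ne_completion_of_neg (by exact_mod_cast hd) _) (normClean_place_menu₅ W hNC) hinf hns
  rw [Nat.cast_ofNat, GenusKolyTwin.natCard_selmerGroup_model_eq_twistSelmerTwoCard W hd0 _ ⟨1, one_smul _ _⟩] at h
  rw [selmerTwoCard, ← h, mul_comm]

/-- **THE NORM-CLEAN TWIST LAW, `d < 0 < Δ_W`: a shift by exactly one `2`-dimension** — `2·#Sel₂(W^{(d)}) = #Sel₂(W)` (some Selmer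
class of `W` non-trivial at `∞`) or `#Sel₂(W^{(d)}) = 2·#Sel₂(W)` (`Sel₂(W)` strict at `∞`), for every globally minimal elliptic `W/ℚ` with
`Δ_W > 0` and every norm-clean `d < 0`. Contains T-A (`DescAdmissible`) and T-A⁵ (`DescAdmissibleUnram`) and adds the odd bad primes that
are multiplicative with `v_ℓ(Δ)` odd and inert. [cite: Kramer1981, Thm. 1, §2 Props. 1, 2 (a), 3, 6] [cite: MazurRubin2010, Thm. 2.7, Cor. 3.4 (i)] -/
theorem twistSelmerTwoCard_shift_of_normClean (hΔ : 0 < W.Δ) {d : ℤ} (hNC : KramerNormCleanSuff W d) (hd : d < 0) :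
    2 * twistSelmerTwoCard W d = selmerTwoCard W ∨ twistSelmerTwoCard W d = 2 * selmerTwoCard W := by
  by_cases hstrict : ∀ c ∈ (W.kummerSelmerStructure ((2 : ℕ) : ℤ)).selmerGroup,
      galoisCohomology.localization (W.torsionGaloisModule ((2 : ℕ) : ℤ)) (Sum.inl Rat.infinitePlace) 1 c = 0
  · exact Or.inr (twistSelmerTwoCard_eq_two_mul_of_strict_of_normClean W hΔ hstrict hNC hd)
  · push Not at hstrict
    obtain ⟨c, hc, hne⟩ := hstrict
    exact Or.inl (two_mul_twistSelmerTwoCard_eq_of_exists_of_normClean W hΔ ⟨c, hc, hne⟩ hNC hd)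

/-- **The level law across ALL norm-clean negative parameters** (`Δ_W > 0`): `#Sel₂(W^{(d)}) = #Sel₂(W^{(d')})` for norm-clean
`d, d' < 0` — the direction of the shift is a property of `W` (the descent sign: strictness of `Sel₂(W)` at `∞`), not of `d`.
[cite: Kramer1981, Thm. 1, §2 Prop. 6] [cite: MazurRubin2010, Thm. 2.7, Cor. 3.4 (i)] -/
theorem twistSelmerTwoCard_eq_of_normClean_neg (hΔ : 0 < W.Δ) {d d' : ℤ}
    (hNC : KramerNormCleanSuff W d) (hNC' : KramerNormCleanSuff W d') (hd : d < 0) (hd' : d' < 0) :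
    twistSelmerTwoCard W d = twistSelmerTwoCard W d' := by
  by_cases hstrict : ∀ c ∈ (W.kummerSelmerStructure ((2 : ℕ) : ℤ)).selmerGroup,
      galoisCohomology.localization (W.torsionGaloisModule ((2 : ℕ) : ℤ)) (Sum.inl Rat.infinitePlace) 1 c = 0
  · rw [twistSelmerTwoCard_eq_two_mul_of_strict_of_normClean W hΔ hstrict hNC hd,
      twistSelmerTwoCard_eq_two_mul_of_strict_of_normClean W hΔ hstrict hNC' hd']
  · push Not at hstrict
    obtain ⟨c, hc, hne⟩ := hstrict
    have h1 := two_mul_twistSelmerTwoCard_eq_of_exists_of_normClean W hΔ ⟨c, hc, hne⟩ hNC hd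
    have h2 := two_mul_twistSelmerTwoCard_eq_of_exists_of_normClean W hΔ ⟨c, hc, hne⟩ hNC' hd'
    omega

end Law

end Summit.BirchSwinnertonDyer.BirchSwinnertonDyer.Theorems.GenusKolyArch

end
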